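import Summits.QuantumFields.YangMills.Theorems.DiagonalMirrorRPRWilsonDiagonalModelNatKernelL2
import Literature.Analysis.OperatorTheory.L2KernelIntegralOperator
import Literature.Analysis.OperatorTheory.CompactSelfAdjointEigenbasis
import Literature.Analysis.OperatorTheory.L2KernelHilbertSchmidt
import Mathlib.MeasureTheory.Measure.SeparableMeasure

/-!
# Crux `DiagonalMirrorRPR` (stmt-QuantumFields-10604), line `sign-twisted-diagonal-trace`, construction F1_diag
# (director-ym O4 WORD 3 (A)), operator layer, step S3: the lifted diagonal transfer OPERATOR `𝔄 = Φ Ô Φ†` on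
# `L²(ℕ × half layer, counting ⊗ Haar)` — bounded, COMPACT, SELF-ADJOINT, HILBERT–SCHMIDT, with a Hilbert basis of
# eigenvectors and square-summable real eigenvalues

Helper for the crux `DiagonalMirrorRPR` of `YangMills` (routes `IsotropyFromPowerCounting`, `MirrorModularBoosts`,
`PencilRigidity`; item stmt-QuantumFields-10604), attached `--supports … --as helper`; it closes nothing by itself.
Continuation of `…WilsonDiagonalModelNatKernelL2` (`natKernel ρ β` symmetric, measurable, square integrable for
`liftMeasure S G = count ⊗ halfHaar`), consuming the tree's `Literature/Analysis/OperatorTheory/L2KernelIntegralOperator`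
(`exists_l2KernelOp_package`, Reed–Simon I Thm VI.22–23) and `…/CompactSelfAdjointEigenbasis` (Thm VI.16).

* `memLp_natKernel` — `𝔞 ∈ L²((count ⊗ halfHaar)²)`;
* ★ **`exists_liftedOp`** — a bounded operator `𝔄` on `L²(count ⊗ halfHaar)` with `𝔄φ =ᵐ ∫ 𝔞(·, y) φ(y)`, COMPACT, SELF-ADJOINT,
  and `Σ_i ‖𝔄 f_i‖² ≤ ∫ 𝔞²` on orthonormal families (Hilbert–Schmidt);
* ★ **`exists_liftedOp_eigenbasis`** — a Hilbert basis of eigenvectors with real eigenvalues `κ_i`, `𝔄 b_i = κ_i b_i`, with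
  `Σ_{i ∈ t} κ_i² ≤ ∫ 𝔞²` for every finite `t` and `Summable (κ ·)²`.

This is the GENUINE operator behind the interface `DiagonalSliceModel` of line #108 for Wilson's measure on the scheme's own
odd torus: the self-adjoint realisation of the diagonal two-step transfer operator `K_u = Ê Ô` through the feature lift
(`Ê = Φ†Φ`, LANDED `hasSum_expFeature_even`), built with NO trace-class theory, NO operator square root and NO new Literature
fact.  OWED toward `def wilsonDiagonalModel : DiagonalSliceModel r sch`: (S4) the trace formulas
`Σ_i κ_i^m = diagCyclicTraceU ρ β m` (HS pairing `…/L2KernelPairing` + the resummation `Σ_k ψ_kψ_k = exp(β⟨w,w′⟩)` + Fubini),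
whence `sp/sm/top` (moduli of the ± eigenvalues, `top = ‖𝔄‖`), `trace_nonneg`/`trace_side_pos` from the LANDED
`diagCyclicTraceU_nonneg`/`_side_pos`; and (P) the `famObs` pairing layer (`pairing_eq`, `weight_dom`).
HONEST FRAMING: a construction helper; nothing about D_old ⟨10604⟩, the RP crux of the FOLD restate, or the summit is
proved; the Yang–Mills mass gap is NOT proved here or anywhere in the tree.

References: M. Reed, B. Simon, *Methods of Modern Mathematical Physics I* (1980) Thm VI.16, VI.22–23; K. Osterwalder,
E. Seiler, Ann. Phys. 110 (1978) §2–3.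
-/

set_option autoImplicit false

noncomputable section

open MeasureTheory
open scoped InnerProductSpace
open Literature.MathematicalPhysics.QuantumLattice Literature.MathematicalPhysics.QuantumFieldTheory
open Summit.QuantumFields.YangMills.Cruxes.DiagonalMirrorRPR.ParityBridgeColdTraces

namespace Summit.QuantumFields.YangMills.Cruxes.DiagonalMirrorRPR.SignTwistedDiagonalTrace.WilsonDiagonal

/-! ## §17 The lifted diagonal transfer OPERATOR `𝔄` on `L²(ℕ × half layer)` -/

section LiftedOp

variable {S : ℕ} [NeZero S] {G : Type} [Group G] {Nc : ℕ} (ρ : G →* Matrix (Fin Nc) (Fin Nc) ℂ)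
variable [TopologicalSpace G] [IsTopologicalGroup G] [CompactSpace G] [MeasurableSpace G] [BorelSpace G]
  [SecondCountableTopology G]

/-- The lifted kernel is in `L²` of the product measure `(counting ⊗ halfHaar)²` (`β ≥ 0`, continuous `ρ`). -/
theorem memLp_natKernel (hρ : Continuous ρ) {β : ℝ} (hβ : 0 ≤ β) :
    MemLp (Function.uncurry (natKernel (S := S) ρ β)) 2 ((liftMeasure S G).prod (liftMeasure S G)) := by
  have hmeas : AEStronglyMeasurable (Function.uncurry (natKernel (S := S) ρ β)) ((liftMeasure S G).prod (liftMeasure S G)) :=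
    (measurable_natKernel (S := S) ρ hρ β).aestronglyMeasurable
  rw [memLp_two_iff_integrable_sq hmeas]
  refine ⟨(measurable_natKernel (S := S) ρ hρ β).pow_const 2 |>.aestronglyMeasurable, ?_⟩
  rw [hasFiniteIntegral_iff_ofReal (ae_of_all _ fun z => sq_nonneg _)]
  exact lintegral_natKernel_sq_lt_top (S := S) ρ hρ hβ

/-- ★ **The lifted diagonal transfer operator.**  For `β ≥ 0` and continuous `ρ` there is a bounded operator `𝔄` on
`L²(ℕ × half layer, counting ⊗ Haar)` acting a.e. by the lifted kernel `𝔞 = natKernel ρ β`; every such operator is COMPACT,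
SELF-ADJOINT (the kernel is symmetric, `natKernel_symm`) and HILBERT–SCHMIDT (`Σ ‖𝔄 f_i‖² ≤ ∫ 𝔞²` on orthonormal families).
This is the self-adjoint realisation `Φ Ô Φ†` of the Wilson diagonal two-step transfer operator `K_u = Ê Ô` of the scheme's own
odd torus (ROADMAP-F1diag v2 §1½), obtained from the tree's `L²`-kernel package with no trace-class input. -/
theorem exists_liftedOp (hρ : Continuous ρ) {β : ℝ} (hβ : 0 ≤ β) :
    ∃ A : Lp ℝ 2 (liftMeasure S G) →L[ℝ] Lp ℝ 2 (liftMeasure S G),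
      (∀ φ : Lp ℝ 2 (liftMeasure S G),
        (A φ : ℕ × HalfCfg S S G → ℝ) =ᵐ[liftMeasure S G] fun x => ∫ y, natKernel ρ β x y * φ y ∂(liftMeasure S G)) ∧
      IsCompactOperator A ∧ IsSelfAdjoint A ∧
      (∀ (m : ℕ) (f : Fin m → Lp ℝ 2 (liftMeasure S G)), Orthonormal ℝ f →
        ∑ i, ‖A (f i)‖ ^ 2 ≤ ∫ z, natKernel ρ β z.1 z.2 ^ 2 ∂((liftMeasure S G).prod (liftMeasure S G))) := by
  haveI : SFinite (liftMeasure S G) := by unfold liftMeasure halfHaar; infer_instance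
  obtain ⟨⟨A, hA⟩, hprops⟩ := Literature.Analysis.OperatorTheory.exists_l2KernelOp_package
    (K := natKernel (S := S) ρ β) (memLp_natKernel (S := S) ρ hρ hβ)
  obtain ⟨hcpt, hsa, hHS, -⟩ := hprops A hA
  exact ⟨A, hA, hcpt, hsa (natKernel_symm ρ β), hHS⟩

/-- ★ **Eigen-data of the lifted diagonal transfer operator** (Hilbert–Schmidt theorem): a Hilbert basis of `L²(counting ⊗ Haar)`
of eigenvectors of `𝔄` with REAL eigenvalues whose squares are summable with sum `≤ ∫ 𝔞²` — the genuine spectral model behind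
the interface fields `sp/sm/top/summable_sp/summable_sm` of `DiagonalSliceModel` (their extraction and the trace formulas
`Σ λ^m = diagCyclicTraceU ρ β m` are OWED). -/
theorem exists_liftedOp_eigenbasis (hρ : Continuous ρ) {β : ℝ} (hβ : 0 ≤ β) :
    ∃ (A : Lp ℝ 2 (liftMeasure S G) →L[ℝ] Lp ℝ 2 (liftMeasure S G))
      (s : Set (Lp ℝ 2 (liftMeasure S G))) (b : HilbertBasis s ℝ (Lp ℝ 2 (liftMeasure S G))) (κ : s → ℝ),
      (∀ φ : Lp ℝ 2 (liftMeasure S G),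
        (A φ : ℕ × HalfCfg S S G → ℝ) =ᵐ[liftMeasure S G] fun x => ∫ y, natKernel ρ β x y * φ y ∂(liftMeasure S G)) ∧
      IsSelfAdjoint A ∧ ⇑b = ((↑) : s → Lp ℝ 2 (liftMeasure S G)) ∧ (∀ i, A (b i) = κ i • b i) ∧
      (∀ t : Finset s, ∑ i ∈ t, κ i ^ 2 ≤ ∫ z, natKernel ρ β z.1 z.2 ^ 2 ∂((liftMeasure S G).prod (liftMeasure S G))) ∧
      Summable fun i => κ i ^ 2 := by
  obtain ⟨A, hA, hcpt, hsa, hHS⟩ := exists_liftedOp (S := S) ρ hρ hβ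
  obtain ⟨s, b, κ, hb, hκ⟩ :=
    Literature.Analysis.OperatorTheory.exists_hilbertBasis_eigenvectors_of_isSelfAdjoint hcpt hsa
  have hκ' : ∀ i, A (b i) = κ i • b i := fun i => by simpa using hκ i
  -- finite partial sums of the squared eigenvalues are bounded by the Hilbert–Schmidt integral
  have hfin : ∀ t : Finset s, ∑ i ∈ t, κ i ^ 2 ≤ ∫ z, natKernel ρ β z.1 z.2 ^ 2 ∂((liftMeasure S G).prod (liftMeasure S G)) := by
    intro t
    -- enumerate `t` and use the orthonormal-family bound
    set m := t.card with hm
    let e : Fin m ≃ t := (t.equivFin).symm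
    have hon : Orthonormal ℝ (fun j : Fin m => (b (e j) : Lp ℝ 2 (liftMeasure S G))) :=
      b.orthonormal.comp (fun j => ((e j) : s)) (fun j j' h => e.injective (Subtype.ext h))
    have h1 := hHS m _ hon
    have hnorm : ∀ j : Fin m, ‖A (b (e j))‖ ^ 2 = κ (e j) ^ 2 := by
      intro j
      rw [hκ' (e j), norm_smul, Real.norm_eq_abs, mul_pow, sq_abs]
      have : ‖(b ((e j) : s) : Lp ℝ 2 (liftMeasure S G))‖ = 1 := b.orthonormal.1 _
      rw [this, one_pow, mul_one]
    simp only [hnorm] at h1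
    calc ∑ i ∈ t, κ i ^ 2 = ∑ j : Fin m, κ (e j) ^ 2 := by
          rw [← Finset.sum_coe_sort t]
          exact (Fintype.sum_equiv e _ _ fun j => rfl).symm
      _ ≤ _ := h1
  refine ⟨A, s, b, κ, hA, hsa, hb, hκ', hfin, ?_⟩
  exact summable_of_sum_le (fun i => sq_nonneg _) hfin

/-! ### The Hilbert–Schmidt identity `Σ κ_i² = ∫ 𝔞²` (the `m = 2` trace formula) -/

omit [NeZero S] [Group G] [TopologicalSpace G] [IsTopologicalGroup G] [CompactSpace G] [MeasurableSpace G] [BorelSpace G]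
  [SecondCountableTopology G] in
/-- An orthonormal family in a separable inner product space has a countable index (disjoint balls of radius `1/2`). -/
theorem countable_of_orthonormal {E : Type*} [NormedAddCommGroup E] [InnerProductSpace ℝ E]
    [TopologicalSpace.SeparableSpace E] {ι : Type*} {v : ι → E} (hv : Orthonormal ℝ v) : Countable ι := by
  -- adapted from `Orthonormal.countable_index_of_separableSpace` (Literature/NumberTheory/Automorphic/AutomorphicL2Separable)
  have hfar : ∀ i j, i ≠ j → 1 < ‖v i - v j‖ := by
    intro i j hij
    have h0 : ⟪v i, v j⟫_ℝ = 0 := hv.2 hij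
    have hsq : ‖v i - v j‖ ^ 2 = 2 := by
      rw [@norm_sub_sq ℝ, hv.1 i, hv.1 j, h0]
      norm_num
    nlinarith [norm_nonneg (v i - v j), hsq]
  refine Pairwise.countable_of_isOpen_disjoint (s := fun i => Metric.ball (v i) (1 / 2))
    (fun i j hij => Metric.ball_disjoint_ball ?_) (fun i => Metric.isOpen_ball)
    fun i => ⟨v i, Metric.mem_ball_self (by norm_num)⟩
  rw [dist_eq_norm]
  linarith [hfar i j hij]

/-- `L²(counting ⊗ halfHaar)` is second countable (the measure is separable: countably generated σ-algebra, s-finite). -/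
theorem secondCountableTopology_Lp_liftMeasure : SecondCountableTopology (Lp ℝ 2 (liftMeasure S G)) := by
  haveI : SFinite ((Measure.count : Measure ℕ).prod (halfHaar S G)) := by unfold halfHaar; infer_instance
  haveI : IsSeparable (liftMeasure S G) := by
    show IsSeparable ((Measure.count : Measure ℕ).prod (halfHaar S G)); infer_instance
  haveI : Fact ((2 : ENNReal) ≠ ⊤) := ⟨ENNReal.ofNat_ne_top⟩
  infer_instance

/-- ★ **The `m = 2` trace formula** `Σ_i κ_i² = ∫ 𝔞² d(ν ⊗ ν)` for the eigenvalues of the lifted diagonal transfer operator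
(Hilbert–Schmidt identity for `L²` kernels, `Literature…L2Kernel.hasSum_norm_sq_op'`; the index set of the eigenbasis is
countable because `L²(ν)` is separable). -/
theorem exists_liftedOp_hasSum_sq (hρ : Continuous ρ) {β : ℝ} (hβ : 0 ≤ β) :
    ∃ (A : Lp ℝ 2 (liftMeasure S G) →L[ℝ] Lp ℝ 2 (liftMeasure S G))
      (s : Set (Lp ℝ 2 (liftMeasure S G))) (b : HilbertBasis s ℝ (Lp ℝ 2 (liftMeasure S G))) (κ : s → ℝ),
      (∀ φ : Lp ℝ 2 (liftMeasure S G),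
        (A φ : ℕ × HalfCfg S S G → ℝ) =ᵐ[liftMeasure S G] fun x => ∫ y, natKernel ρ β x y * φ y ∂(liftMeasure S G)) ∧
      IsSelfAdjoint A ∧ ⇑b = ((↑) : s → Lp ℝ 2 (liftMeasure S G)) ∧ (∀ i, A (b i) = κ i • b i) ∧ Countable s ∧
      HasSum (fun i => κ i ^ 2) (∫ z, natKernel ρ β z.1 z.2 ^ 2 ∂((liftMeasure S G).prod (liftMeasure S G))) := by
  haveI : SFinite (liftMeasure S G) := by unfold liftMeasure halfHaar; infer_instance
  haveI := secondCountableTopology_Lp_liftMeasure (S := S) (G := G)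
  obtain ⟨A, s, b, κ, hA, hsa, hb, hκ, -, -⟩ := exists_liftedOp_eigenbasis (S := S) ρ hρ hβ
  haveI hcount : Countable s := countable_of_orthonormal b.orthonormal
  refine ⟨A, s, b, κ, hA, hsa, hb, hκ, hcount, ?_⟩
  have h := Literature.Analysis.OperatorTheory.L2Kernel.hasSum_norm_sq_op' (memLp_natKernel (S := S) ρ hρ hβ) hA b
  have hnorm : ∀ i, ‖A (b i)‖ ^ 2 = κ i ^ 2 := by
    intro i
    rw [hκ i, norm_smul, Real.norm_eq_abs, mul_pow, sq_abs]
    have : ‖(b i : Lp ℝ 2 (liftMeasure S G))‖ = 1 := b.orthonormal.1 _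
    rw [this, one_pow, mul_one]
  simp only [hnorm, Function.uncurry, Real.norm_eq_abs, sq_abs] at h
  exact h

end LiftedOp

end Summit.QuantumFields.YangMills.Cruxes.DiagonalMirrorRPR.SignTwistedDiagonalTrace.WilsonDiagonal

end
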